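import Summits.Ventures.PercRepro2.CaseOneStarCertT1
import Summits.Ventures.PercRepro2.CaseOneGadgetUWA1BBlockII0
import Summits.Ventures.PercRepro2.CaseOneGadgetUWA1BBlockII1
import Summits.Ventures.PercRepro2.CaseOneGadgetUWA1BBlockII2
import Summits.Ventures.PercRepro2.CaseOneGadgetUWA1BBlockII3
import Summits.Ventures.PercRepro2.CaseOneGadgetUWA1BBlockII4
import Summits.Ventures.PercRepro2.CaseOneGadgetUWA1BBlockII5
import Summits.Ventures.PercRepro2.CaseOneGadgetUWA1BBlockII6
import Summits.Ventures.PercRepro2.CaseOneGadgetUWA1BBlockII7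
import Summits.Ventures.PercRepro2.CaseOneGadgetUWA1BBlockII8
import Summits.Ventures.PercRepro2.CaseOneGadgetUWA1BBlockII9
import Summits.Ventures.PercRepro2.CaseOneGadgetUWA1BBlockII10
import Summits.Ventures.PercRepro2.CaseOneGadgetUWA1BBlockII11
import Summits.Ventures.PercRepro2.CaseOneGadgetUWA1BBlockII12
import Summits.Ventures.PercRepro2.CaseOneGadgetUWA1BBlockII13
import Summits.Ventures.PercRepro2.CaseOneGadgetUWA1BBlockII14
import Summits.Ventures.PercRepro2.CaseOneStarFactsB

/-!
# The gadget `u ~ {w, a₁, b}`, `w ~ {u, a₂, o}` (uwa1b): the cell certificates of `iiAB5` (part 24d)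
(blind cell PercRepro2, p1 g34; the fourth gadget anchor of the six-form calculus — all six forms of the uwa1b gadget
as plain SFacts-cone certificate chains, generated by mining/p1/g34/uwa1b/genu.py = p1 g33's gent_uwa1.py / g25's
geno.py re-targeted; P1-G33 §6–§6″, P1-G34)

Each `eBABII ijk kl` is a nonnegative combination of `(pairwise atom) × (cell)` and cubic cell monomials — or, for the degree-4 ones, `M × eBABII ijk kl` (`M = Σ cᵢ` the total cell mass) is a nonnegative combination of `(atom) × (cell) × (cell)` and quartic cell monomials, then `SFacts.nonneg_of_sum_mul` (`CaseOneStarCertT1`) — exact LP certificates (kit j318477, every certificate re-verified exactly; data/p1/g33/gcerts_ii_uwa1b.json, form `ii`), here as exact `linear_combination`s over `SFacts` (the rational coefficients cleared by their common denominator). -/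

namespace Summit.Ventures.PercRepro2

namespace CaseOne

section CertABII24d
variable {R : Type*} [Field R] [LinearOrder R] [IsStrictOrderedRing R]

set_option maxHeartbeats 0 in
/-- `eBABII13321 ≥ 0`: the combination is identically zero (`ring`). -/
lemma eBABII13321_nonneg (m : SCells R) (_hf : SFactsB m) : 0 ≤ eBABII13321 m := by
  have h : eBABII13321 m = 0 := by
    unfold eBABII13321 cBABII00121 cBABII00221 cBABII01021 cBABII01121 cBABII01221 cBABII01321 cBABII02021 cBABII02121 cBABII02221 cBABII02321 cBABII03121 cBABII03221 cBABII03321 cBABII10021 cBABII10121 cBABII10221 cBABII10321 cBABII11021 cBABII11121 cBABII11221 cBABII11321 cBABII12021 cBABII12121 cBABII12221 cBABII12321 cBABII13021 cBABII13121 cBABII13221 cBABII13321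
    ring
  linarith [h]

set_option maxHeartbeats 0 in
/-- `eBABII13322 ≥ 0`: the combination is identically zero (`ring`). -/
lemma eBABII13322_nonneg (m : SCells R) (_hf : SFactsB m) : 0 ≤ eBABII13322 m := by
  have h : eBABII13322 m = 0 := by
    unfold eBABII13322 cBABII00122 cBABII00222 cBABII01022 cBABII01122 cBABII01222 cBABII01322 cBABII02022 cBABII02122 cBABII02222 cBABII02322 cBABII03122 cBABII03222 cBABII03322 cBABII10022 cBABII10122 cBABII10222 cBABII10322 cBABII11022 cBABII11122 cBABII11222 cBABII11322 cBABII12022 cBABII12122 cBABII12222 cBABII12322 cBABII13022 cBABII13122 cBABII13222 cBABII13322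
    ring
  linarith [h]

end CertABII24d

end CaseOne

end Summit.Ventures.PercRepro2
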